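import Literature.NumberTheory.ComplexMultiplication.FiniteQAlgebraLatticeLocallyPrincipal
import HarnessLib

/-!
# DIVIDING OUT THE RADICAL, def-free: a ring homomorphism `π : A → B` of finite-dimensional commutative
# `ℚ`-algebras maps full lattices to full lattices, products to products, orders to orders, `ε`- and `w`-classes to
# `ε`- and `w`-classes, INVERTIBLE lattices to invertible lattices with `𝒪(πL) = π𝒪(L)`, `(πL)⁻¹ = π(L⁻¹)`, and —
# when `π` has a multiplicative section — `G(Λ) → G(πΛ)`, `L ↦ πL`, is SURJECTIVE (Hertling–Larabi 2026 §9
# Lemma 9.1, Theorem 9.2 for `pr_F : A = F ⊕ R → F`; Hertling–Larabi 2026b Lemma 5.9, Thm. 5.10) — nilpotents allowed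

[topic NumberTheory/ComplexMultiplication] General-`A` series (namespace
`Literature.NumberTheory.ComplexMultiplication.FiniteQAlgebraLattice`); sequel of `FiniteQAlgebraLatticeLocalization`
(Thm. 7.2 (c) gluing, Thm. 7.3 «⇐»), `FiniteQAlgebraLatticeLocallyPrincipal` (Thm. 7.3 «⇒» [Fa65]) and
`FiniteQAlgebraLatticeWeakEquivalence` §6 (`eq_div_self_of_mul_eq_of_mul_eq`: `e_L = 𝒪(L)`;
`eq_div_div_of_mul_eq_div_self`: `L⁻¹ = 𝒪(L):L`).  Lane `lit-hodgefound` (Track 2 foundations library), seat p19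
generation 36, row g36-#11.  THEOREMS ONLY: no definition, no instance, no notation, no named fact (D-0026, net
Literature debt `0`), no `sorry`.

DEF-FREE SPELLING.  HL's `A = F ⊕ R` (Thm. 3.1: `F` the separable subalgebra, `R` the radical) and the projection
`pr_F : A → F` are replaced by an ARBITRARY ring homomorphism `π : A →+* B` between commutative rings (finite-
dimensional commutative `ℚ`-algebras where fullness is used); where HL use that `pr_F` is onto we assume
`Function.Surjective π`, and where they use `F ⊂ A`, `F^{unit} ⊂ A^{unit}` we assume a multiplicative section
`σ : B →+* A`, `π (σ b) = b` (for `pr_F` this is the inclusion `F ↪ A`).  The image lattice `pr_F L` is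
`L.map (π : A →+ B).toIntLinearMap` (the tree's spelling, `FiniteQAlgebraLatticeMaximalOrderInvertible.map_mul_eq`);
«`L_1`, `L_2` agree at `p`» is `FiniteQAlgebraLatticeLocalization`'s `∃ s : ℤ, ¬ ↑p ∣ s ∧ sL_1 ⊆ L_2 ∧ sL_2 ⊆ L_1`.

## Source, VERBATIM

C. Hertling, K. Larabi, *Semigroups from full lattices in commutative ℚ-algebras*, arXiv:2602.14973 (2026)
[HertlingLarabi2026], held `paper:arxiv-2602.14973`, §9 «Dividing out the radical» (chunk p0024): «Recall that the
radical `R = ⊕_{j=1}^k N^{(j)}` is an ideal, and all its elements are nilpotent. Recall the separable subalgebra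
`F := ⊕_{j=1}^k F^{(j)} ⊂ A` of `A`, the natural decomposition `A = F ⊕ R`, and the induced projection `pr_F : A → F`.
By Remark 3.2 (ii) it respects addition, multiplication and division in `A` and `F`. […] **Lemma 9.1.** (a) The
image `pr_FL` of a full lattice in `A` is a full lattice in `F`. The projection `pr_F : A → F` is compatible with the
multiplication in `𝓛(A)` and `𝓛(F)`, `pr_F(L_1·L_2) = pr_F L_1·pr_F L_2` for `L_1, L_2 ∈ 𝓛(A)` (9.1). It induces a
surjective homomorphism `pr_F : 𝓛(A) → 𝓛(F)` of semigroups. Especially, it maps idempotents to idempotents, so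
orders to orders. So it restricts to a surjective homomorphism `pr_F : {orders in A} → {orders in F}` (9.2) of
semigroups. Though it does not respect the division maps. In general we only have
`pr_F(L_1:L_2) ⊂ pr_F L_1:pr_FL_2` for `L_1, L_2 ∈ 𝓛(A)` (9.3). (b) The projection `pr_F : 𝓛(A) → 𝓛(F)` respects
`ε`-equivalence and `w`-equivalence. Therefore it induces surjective homomorphisms `pr_F : 𝓔(A) → 𝓔(F)` (9.4),
`pr_F : W(𝓛(A)) → W(𝓛(F))` (9.5) of semigroups. (c) In general, for `L ∈ 𝓛(A)` we only have an inclusion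
`pr_F𝒪(L) ⊂ 𝒪(pr_FL)`. But if `L` is invertible then `pr_FL` is invertible with `𝒪(pr_FL) = pr_F(𝒪(L))` and
`(pr_FL)⁻¹ = pr_F(L⁻¹)`. (d) Let `Λ` be an order in `L`. Write `Λ_0 := pr_FΛ` for the induced order in `F`. Part (c)
gives rise to two group homomorphisms, `G(Λ) → G(Λ_0), L ↦ pr_FL` (9.6), `G([Λ]_ε) → G([Λ_0]_ε),
[L]_ε ↦ [pr_FL]_ε` (9.7). *Proof:* The parts (a) and (b) are obvious. The inclusion `pr_F𝒪(L) ⊂ 𝒪(pr_FL)` follows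
from (9.3). Let `L ∈ 𝒪(L)` be invertible. Then by (9.1) `pr_FL·pr_FL⁻¹ = pr_F(L·L⁻¹) = pr_F(𝒪(L))`, and therefore
`pr_FL` is invertible with `𝒪(pr_FL) = pr_F𝒪(L)` and `(pr_FL)⁻¹ = pr_FL⁻¹`. Now part (d) is obvious. □ The group
homomorphisms in (9.6) and (9.7) have surprisingly good properties. The more difficult part of Theorem 9.2 is due to
Faddeev [Fa68], namely the injectivity of the map in (9.7). **Theorem 9.2.** The group homomorphism in (9.6) is
surjective. The group homomorphism in (9.7) is an isomorphism. *Proof:* We show that the group homomorphism in (9.6)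
is surjective. […] Let `L_0 ∈ G(Λ_0)`, so `L_0 ∈ 𝓛(F)` is invertible with `𝒪(L_0) = Λ_0`. By Theorem 7.3 there is an
element `a_p ∈ F^{unit}` for each `p ∈ ℙ` with `(L_0)_(p) = a_p(Λ_0)_(p)`, and there is a finite set `P_0 ⊂ ℙ` such
that we can choose `a_p = 1` for `p ∈ ℙ − P_0`. Of course `F^{unit} ⊂ A^{unit}`. By Theorem 7.2 (c) there is a
unique full lattice `L` in `A` with `L_(p) = a_pΛ_(p)` for each `p ∈ ℙ`. By Theorem 7.3 it is invertible with
`𝒪(L) = Λ`. Of course `pr_F(L) = L_0`. This shows the surjectivity of the maps in (9.6) and (9.7). The map in (9.7)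
is injective by [Fa68]. □»  (Restated as Lemma 5.9 and Thm. 5.10 of C. Hertling, K. Larabi, arXiv:2602.15748
[HertlingLarabi2026b], §5, chunk p0010.)

## What is proved (`π : A →+* B` a ring homomorphism of commutative rings, `σ : B →+* A` with `π ∘ σ = id` where
## said; `M.map (π : A →+ B).toIntLinearMap` = `π(M)`; `ℚ`-algebra structure only where fullness is used)

* §1 LEMMA 9.1 (a): **`map_mul_eq_map_mul_map`** ((9.1) `π(L_1L_2) = π(L_1)π(L_2)`), `map_mul_self_eq_of_mul_self_eq`
  (idempotents ↦ idempotents), `one_mem_map`, `map_mul_map_le` (orders ↦ orders),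
  **`isFullLattice_map_of_surjective`** (`π(L)` is full), **`map_div_le`** ((9.3) `π(L_1:L_2) ⊆ π(L_1):π(L_2)`),
  `map_div_self_le` (`π𝒪(L) ⊆ 𝒪(πL)`), `locEq_map` (`π` respects agreement at `p`), and the surjectivity
  `𝓛(A) → 𝓛(B)`: **`exists_isFullLattice_map_eq`** (given a section `σ`: every full `L_0 ⊂ B` is `π(L)`, namely of
  `L = σ(L_0) + nM` for a full `M ⊂ A` and `nπ(M) ⊆ L_0`).
* §1 LEMMA 9.1 (b): **`map_units_smul`** (`π(uM) = π(u)π(M)`: `ε`-classes ↦ `ε`-classes),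
  **`one_mem_div_mul_div_map`** (`1 ∈ (L_1:L_2)(L_2:L_1) ⟹ 1 ∈ (πL_1:πL_2)(πL_2:πL_1)`: `w`-classes ↦ `w`-classes).
* §2 LEMMA 9.1 (c)(d): **`map_invertible_of_mul_div_div_eq`** — for surjective `π` and invertible full `L`:
  `π(L)` is invertible, `𝒪(πL) = π𝒪(L)`, `(πL)⁻¹ = π(L⁻¹)` (so `L ↦ πL` maps `G(Λ)` to `G(πΛ)`).
* §3 THEOREM 9.2, SURJECTIVITY: **`exists_invertible_map_eq`** — for an order `Λ ⊂ A`, a section `σ` of `π` and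
  `L_0 ∈ G(πΛ)` (full, `𝒪(L_0) = πΛ`, invertible) there is `L ∈ G(Λ)` with `πL = L_0` (HL's proof: Thm. 7.3 «⇒» in
  `B`, units lifted along `σ`, gluing Thm. 7.2 (c) and Thm. 7.3 «⇐» in `A`, `πL = L_0` prime by prime).
NOT here: the injectivity of (9.7) `G([Λ]_ε) → G([Λ_0]_ε)` (Faddeev 1968, cited by HL without proof).

## References
* [HertlingLarabi2026] C. Hertling, K. Larabi, arXiv:2602.14973 (2026), §9 Lemma 9.1, Thm. 9.2 (chunk p0024); §7
  Thm. 7.2 (c), Thm. 7.3 (chunk p0018). [cite: HertlingLarabi2026, §9 Lemma 9.1 and Thm. 9.2, chunk p0024]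
* [HertlingLarabi2026b] C. Hertling, K. Larabi, arXiv:2602.15748 (2026), §5 Lemma 5.9, Thm. 5.10 (chunk p0010).
  [cite: HertlingLarabi2026b, §5 Lemma 5.9 and Thm. 5.10, chunk p0010]
-/

noncomputable section

open scoped Pointwise
open Module Function
open Literature.NumberTheory.Automorphic (IsFullLattice mem_units_smul_submodule_iff exists_smul_mem_of_fg
  isFullLattice_span_of_basis)

namespace Literature.NumberTheory.ComplexMultiplication.FiniteQAlgebraLattice

/-! ## §1 Lemma 9.1 (a)(b): products, fullness, colons, orders, `ε`- and `w`-classes under `π` -/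

section Hom

variable {A B : Type} [CommRing A] [CommRing B]

/-- **LEMMA 9.1 (a) (9.1): `π(L_1·L_2) = π(L_1)·π(L_2)`** — `π` induces a homomorphism `𝓛(A) → 𝓛(B)` of
semigroups. [cite: HertlingLarabi2026, §9 Lemma 9.1 (a) (9.1), chunk p0024] -/
theorem map_mul_eq_map_mul_map (π : A →+* B) (M N : Submodule ℤ A) :
    (M * N).map (π : A →+ B).toIntLinearMap =
      M.map (π : A →+ B).toIntLinearMap * N.map (π : A →+ B).toIntLinearMap := by
  have h : (π : A →+ B).toIntLinearMap = (π.toIntAlgHom).toLinearMap := LinearMap.ext fun _ => rfl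
  rw [h, Submodule.map_mul]

/-- **LEMMA 9.1 (a): `π` maps idempotents to idempotents** («Especially, it maps idempotents to idempotents, so
orders to orders»). [cite: HertlingLarabi2026, §9 Lemma 9.1 (a), chunk p0024] -/
theorem map_mul_self_eq_of_mul_self_eq (π : A →+* B) {Λ : Submodule ℤ A} (h : Λ * Λ = Λ) :
    Λ.map (π : A →+ B).toIntLinearMap * Λ.map (π : A →+ B).toIntLinearMap =
      Λ.map (π : A →+ B).toIntLinearMap := by
  rw [← map_mul_eq_map_mul_map, h]

/-- `1 ∈ Λ ⟹ 1 ∈ π(Λ)` (orders ↦ orders, (9.2)). [cite: HertlingLarabi2026, §9 Lemma 9.1 (a) (9.2), chunk p0024] -/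
theorem one_mem_map (π : A →+* B) {Λ : Submodule ℤ A} (h1 : (1 : A) ∈ Λ) :
    (1 : B) ∈ Λ.map (π : A →+ B).toIntLinearMap :=
  ⟨1, h1, by simp⟩

/-- `ΛΛ ⊆ Λ ⟹ π(Λ)π(Λ) ⊆ π(Λ)` (orders ↦ orders, (9.2)). [cite: HertlingLarabi2026, §9 Lemma 9.1 (a) (9.2), chunk p0024] -/
theorem map_mul_map_le (π : A →+* B) {Λ : Submodule ℤ A} (hΛΛ : Λ * Λ ≤ Λ) :
    Λ.map (π : A →+ B).toIntLinearMap * Λ.map (π : A →+ B).toIntLinearMap ≤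
      Λ.map (π : A →+ B).toIntLinearMap := by
  rw [← map_mul_eq_map_mul_map]
  exact Submodule.map_mono hΛΛ

/-- **LEMMA 9.1 (a): the image `π(L)` of a full lattice under a SURJECTIVE `π` is a full lattice** («The image `pr_FL`
of a full lattice in `A` is a full lattice in `F`»). [cite: HertlingLarabi2026, §9 Lemma 9.1 (a), chunk p0024] -/
theorem isFullLattice_map_of_surjective {π : A →+* B} (hπ : Surjective π) {M : Submodule ℤ A}
    (hM : IsFullLattice A M) : IsFullLattice B (M.map (π : A →+ B).toIntLinearMap) := by
  refine ⟨hM.1.map _, fun d => ?_⟩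
  obtain ⟨a, rfl⟩ := hπ d
  obtain ⟨n, hn, hna⟩ := hM.2 a
  exact ⟨n, hn, n • a, hna, by simp⟩

/-- **LEMMA 9.1 (a) (9.3): `π(L_1:L_2) ⊆ π(L_1):π(L_2)`** («it does not respect the division maps. In general we only
have» the inclusion). [cite: HertlingLarabi2026, §9 Lemma 9.1 (a) (9.3), chunk p0024] -/
theorem map_div_le (π : A →+* B) (M N : Submodule ℤ A) :
    (M / N).map (π : A →+ B).toIntLinearMap ≤
      M.map (π : A →+ B).toIntLinearMap / N.map (π : A →+ B).toIntLinearMap := by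
  rintro _ ⟨x, hx, rfl⟩
  refine Submodule.mem_div_iff_forall_mul_mem.2 ?_
  rintro _ ⟨n, hn, rfl⟩
  exact ⟨x * n, Submodule.mem_div_iff_forall_mul_mem.1 hx n hn, by simp⟩

/-- **LEMMA 9.1 (c), first half: `π𝒪(L) ⊆ 𝒪(πL)`** («follows from (9.3)»).
[cite: HertlingLarabi2026, §9 Lemma 9.1 (c), chunk p0024] -/
theorem map_div_self_le (π : A →+* B) (M : Submodule ℤ A) :
    (M / M).map (π : A →+ B).toIntLinearMap ≤
      M.map (π : A →+ B).toIntLinearMap / M.map (π : A →+ B).toIntLinearMap :=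
  map_div_le π M M

/-- `π` respects agreement at a prime `p` (`π(sx) = sπ(x)`): if `L_1`, `L_2` agree at `p` then so do `π(L_1)`,
`π(L_2)` — `pr_F(L_(p)) = (pr_FL)_(p)`. [cite: HertlingLarabi2026, §9 Thm. 9.2 (proof: «Of course `pr_F(L) = L_0`»), chunk p0024] -/
theorem locEq_map (π : A →+* B) {p : ℕ} {M N : Submodule ℤ A}
    (h : ∃ s : ℤ, ¬ (p : ℤ) ∣ s ∧ (∀ x ∈ M, s • x ∈ N) ∧ (∀ x ∈ N, s • x ∈ M)) :
    ∃ s : ℤ, ¬ (p : ℤ) ∣ s ∧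
      (∀ y ∈ M.map (π : A →+ B).toIntLinearMap, s • y ∈ N.map (π : A →+ B).toIntLinearMap) ∧
      (∀ y ∈ N.map (π : A →+ B).toIntLinearMap, s • y ∈ M.map (π : A →+ B).toIntLinearMap) := by
  obtain ⟨s, hs, h₁, h₂⟩ := h
  refine ⟨s, hs, ?_, ?_⟩
  · rintro _ ⟨x, hx, rfl⟩
    exact ⟨s • x, h₁ x hx, by simp⟩
  · rintro _ ⟨x, hx, rfl⟩
    exact ⟨s • x, h₂ x hx, by simp⟩

/-- **LEMMA 9.1 (a): `𝓛(A) → 𝓛(B)`, `L ↦ π(L)`, is ONTO when `π` has a section `σ`** («It induces a surjective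
homomorphism `pr_F : 𝓛(A) → 𝓛(F)` of semigroups»): a full `L_0 ⊂ B` is `π(L)` for the full lattice
`L = σ(L_0) + nM`, `M ⊂ A` full, `nπ(M) ⊆ L_0`. [cite: HertlingLarabi2026, §9 Lemma 9.1 (a), chunk p0024] -/
theorem exists_isFullLattice_map_eq [Algebra ℚ A] [Module.Finite ℚ A] {π : A →+* B} {σ : B →+* A}
    (hσ : ∀ b, π (σ b) = b) {L₀ : Submodule ℤ B} (hL₀ : IsFullLattice B L₀) :
    ∃ L : Submodule ℤ A, IsFullLattice A L ∧ L.map (π : A →+ B).toIntLinearMap = L₀ := by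
  have hM := isFullLattice_span_of_basis (Module.finBasis ℚ A)
  obtain ⟨n, hn, hnM⟩ := exists_smul_mem_of_fg hL₀ (hM.1.map (π : A →+ B).toIntLinearMap)
  refine ⟨L₀.map (σ : B →+ A).toIntLinearMap ⊔
      (Submodule.span ℤ (Set.range (Module.finBasis ℚ A))).map (DistribSMul.toLinearMap ℤ A n),
    ⟨(hL₀.1.map _).sup (hM.1.map _), fun d => ?_⟩, ?_⟩
  · obtain ⟨k, hk, hkd⟩ := hM.2 d
    refine ⟨n * k, mul_ne_zero hn hk, Submodule.mem_sup_right ⟨k • d, hkd, ?_⟩⟩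
    rw [DistribSMul.toLinearMap_apply, mul_smul]
  · rw [Submodule.map_sup]
    have hid : (L₀.map (σ : B →+ A).toIntLinearMap).map (π : A →+ B).toIntLinearMap = L₀ := by
      ext y
      constructor
      · intro hy
        obtain ⟨w, hw, rfl⟩ := Submodule.mem_map.1 hy
        obtain ⟨z, hz, hzw⟩ := Submodule.mem_map.1 hw
        subst hzw
        show π (σ z) ∈ L₀
        rwa [hσ]
      · intro hy
        exact ⟨σ y, ⟨y, hy, rfl⟩, hσ y⟩
    rw [hid, sup_eq_left]
    intro y hy
    obtain ⟨w, hw, rfl⟩ := Submodule.mem_map.1 hy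
    obtain ⟨m, hm, hmw⟩ := Submodule.mem_map.1 hw
    subst hmw
    show π (DistribSMul.toLinearMap ℤ A n m) ∈ L₀
    rw [DistribSMul.toLinearMap_apply, map_zsmul]
    exact hnM _ ⟨m, hm, rfl⟩

/-- **LEMMA 9.1 (b): `π(uM) = π(u)π(M)`** — `π` respects `ε`-equivalence and induces `𝓔(A) → 𝓔(B)` (9.4).
[cite: HertlingLarabi2026, §9 Lemma 9.1 (b) (9.4), chunk p0024] -/
theorem map_units_smul (π : A →+* B) (u : Aˣ) (M : Submodule ℤ A) :
    (u • M).map (π : A →+ B).toIntLinearMap =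
      Units.map (π : A →* B) u • M.map (π : A →+ B).toIntLinearMap := by
  have hu : π (u : A) = (Units.map (π : A →* B) u : B) := rfl
  ext y
  constructor
  · intro hy
    obtain ⟨x, hx, rfl⟩ := Submodule.mem_map.1 hy
    rw [mem_units_smul_submodule_iff] at hx
    rw [mem_units_smul_submodule_iff]
    refine ⟨_, hx, ?_⟩
    show π ((u⁻¹ : Aˣ) • x) = (Units.map (π : A →* B) u)⁻¹ • π x
    rw [← map_inv, Units.smul_def, Units.smul_def, smul_eq_mul, smul_eq_mul, map_mul]
    rfl
  · intro hy
    rw [mem_units_smul_submodule_iff] at hy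
    obtain ⟨m, hm, hmy⟩ := hy
    refine ⟨u • m, Submodule.smul_mem_pointwise_smul m u M hm, ?_⟩
    show π (u • m) = y
    have hmy' : π m = ((Units.map (π : A →* B) u)⁻¹ : Bˣ) • y := hmy
    rw [Units.smul_def, smul_eq_mul, map_mul, hmy', Units.smul_def, smul_eq_mul, hu, Units.mul_inv_cancel_left]

/-- **LEMMA 9.1 (b): `π` respects `w`-equivalence — `1 ∈ (L_1:L_2)(L_2:L_1) ⟹ 1 ∈ (πL_1:πL_2)(πL_2:πL_1)`** (by (9.1)
and (9.3); no fullness hypothesis), so `π` induces `W(𝓛(A)) → W(𝓛(B))` (9.5).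
[cite: HertlingLarabi2026, §9 Lemma 9.1 (b) (9.5) with §5 Thm. 5.7 (a), chunks p0024, p0013] -/
theorem one_mem_div_mul_div_map (π : A →+* B) {L₁ L₂ : Submodule ℤ A}
    (h : (1 : A) ∈ (L₁ / L₂) * (L₂ / L₁)) :
    (1 : B) ∈ (L₁.map (π : A →+ B).toIntLinearMap / L₂.map (π : A →+ B).toIntLinearMap) *
      (L₂.map (π : A →+ B).toIntLinearMap / L₁.map (π : A →+ B).toIntLinearMap) := by
  have h1 : (1 : B) ∈ ((L₁ / L₂) * (L₂ / L₁)).map (π : A →+ B).toIntLinearMap := ⟨1, h, by simp⟩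
  rw [map_mul_eq_map_mul_map] at h1
  exact mul_le_mul' (map_div_le π L₁ L₂) (map_div_le π L₂ L₁) h1

end Hom

/-! ## §2 Lemma 9.1 (c)(d): invertible lattices stay invertible, `𝒪(πL) = π𝒪(L)`, `(πL)⁻¹ = π(L⁻¹)` -/

section Invertible

variable {A B : Type} [CommRing A] [CommRing B] [Algebra ℚ A] [Algebra ℚ B]

/-- **LEMMA 9.1 (c)(d): for a SURJECTIVE `π` and an INVERTIBLE full lattice `L`, the image `π(L)` is invertible with
`𝒪(πL) = π𝒪(L)` and `(πL)⁻¹ = π(L⁻¹)`** («by (9.1) `pr_FL·pr_FL⁻¹ = pr_F(L·L⁻¹) = pr_F(𝒪(L))`, and therefore `pr_FL`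
is invertible with `𝒪(pr_FL) = pr_F𝒪(L)` and `(pr_FL)⁻¹ = pr_FL⁻¹`»: `π𝒪(L)` is a full idempotent `E` with
`πL·E = πL`, `πL·π(L⁻¹) = E`, so `E = 𝒪(πL)` by `eq_div_self_of_mul_eq_of_mul_eq` (`e_{πL} = 𝒪(πL)`), and
`π(L⁻¹) = (πL)⁻¹` by `eq_div_div_of_mul_eq_div_self`); hence `L ↦ πL` maps `G(Λ)` into `G(πΛ)` (9.6).
[cite: HertlingLarabi2026, §9 Lemma 9.1 (c)(d) (9.6), chunk p0024] -/
theorem map_invertible_of_mul_div_div_eq {π : A →+* B} (hπ : Surjective π) {M : Submodule ℤ A}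
    (hM : IsFullLattice A M) (hinv : M * ((M / M) / M) = M / M) :
    M.map (π : A →+ B).toIntLinearMap *
        ((M.map (π : A →+ B).toIntLinearMap / M.map (π : A →+ B).toIntLinearMap) /
          M.map (π : A →+ B).toIntLinearMap) =
      M.map (π : A →+ B).toIntLinearMap / M.map (π : A →+ B).toIntLinearMap ∧
    M.map (π : A →+ B).toIntLinearMap / M.map (π : A →+ B).toIntLinearMap =
      (M / M).map (π : A →+ B).toIntLinearMap ∧
    (M.map (π : A →+ B).toIntLinearMap / M.map (π : A →+ B).toIntLinearMap) /
        M.map (π : A →+ B).toIntLinearMap =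
      ((M / M) / M).map (π : A →+ B).toIntLinearMap := by
  have hE : IsFullLattice B ((M / M).map (π : A →+ B).toIntLinearMap) :=
    isFullLattice_map_of_surjective hπ (isFullLattice_div hM hM)
  -- `πL·π(L⁻¹) = π𝒪(L)` and `πL·π𝒪(L) = πL`
  have hML₂ : M.map (π : A →+ B).toIntLinearMap * ((M / M) / M).map (π : A →+ B).toIntLinearMap =
      (M / M).map (π : A →+ B).toIntLinearMap := by
    rw [← map_mul_eq_map_mul_map, hinv]
  have hME : M.map (π : A →+ B).toIntLinearMap * (M / M).map (π : A →+ B).toIntLinearMap =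
      M.map (π : A →+ B).toIntLinearMap := by
    rw [← map_mul_eq_map_mul_map, mul_comm, div_self_mul_eq_self]
  have hO : (M / M).map (π : A →+ B).toIntLinearMap =
      M.map (π : A →+ B).toIntLinearMap / M.map (π : A →+ B).toIntLinearMap :=
    eq_div_self_of_mul_eq_of_mul_eq hE hML₂ hME
  refine ⟨mul_div_div_eq_of_exists_mul_eq_div_self ⟨_, hML₂.trans hO⟩, hO.symm, ?_⟩
  -- `𝒪(πL)·π(L⁻¹) = π(𝒪(L)L⁻¹) = π(L⁻¹)`, so `π(L⁻¹) = (πL)⁻¹`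
  have e : (M / M) * ((M / M) / M) = (M / M) / M := by
    have h := div_self_mul_div_eq (M / M) M
    rwa [div_self_div_div_self] at h
  refine (eq_div_div_of_mul_eq_div_self (hML₂.trans hO) ?_).symm
  rw [← hO, ← map_mul_eq_map_mul_map, e]

end Invertible

/-! ## §3 Theorem 9.2: `G(Λ) → G(πΛ)`, `L ↦ πL`, is surjective -/

section Surjective

variable {A B : Type} [CommRing A] [CommRing B] [Algebra ℚ A] [Algebra ℚ B]

/-- **THEOREM 9.2, SURJECTIVITY of (9.6) ∕ (9.7): for an order `Λ ⊂ A`, a ring homomorphism `π : A → B` with a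
multiplicative section `σ` (`π ∘ σ = id`; for `pr_F` the inclusion `F ⊂ A`, «Of course `F^{unit} ⊂ A^{unit}`») and an
invertible full lattice `L_0 ⊂ B` with `𝒪(L_0) = Λ_0 := π(Λ)`, there is an invertible full lattice `L ⊂ A` with
`𝒪(L) = Λ` and `π(L) = L_0`** — HL's proof: «By Theorem 7.3 there is an element `a_p ∈ F^{unit}` for each `p ∈ ℙ`
with `(L_0)_(p) = a_p(Λ_0)_(p)` […] `a_p = 1` for `p ∈ ℙ − P_0`. […] By Theorem 7.2 (c) there is a unique full
lattice `L` in `A` with `L_(p) = a_pΛ_(p)` for each `p ∈ ℙ`. By Theorem 7.3 it is invertible with `𝒪(L) = Λ`. Of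
course `pr_F(L) = L_0`» (the units `a_p` are lifted along `σ`; `π(L)` and `L_0` agree at every prime).
[cite: HertlingLarabi2026, §9 Thm. 9.2, chunk p0024] [cite: HertlingLarabi2026b, §5 Thm. 5.10 («The group homomorphism in (5.16) is surjective»), chunk p0010] -/
theorem exists_invertible_map_eq {π : A →+* B} {σ : B →+* A} (hσ : ∀ b, π (σ b) = b)
    {Λ : Submodule ℤ A} (hΛ : IsFullLattice A Λ) (h1 : (1 : A) ∈ Λ) (hΛΛ : Λ * Λ ≤ Λ)
    {L₀ : Submodule ℤ B} (hL₀ : IsFullLattice B L₀)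
    (hO₀ : L₀ / L₀ = Λ.map (π : A →+ B).toIntLinearMap) (hinv₀ : L₀ * ((L₀ / L₀) / L₀) = L₀ / L₀) :
    ∃ L : Submodule ℤ A, IsFullLattice A L ∧ L / L = Λ ∧ L * ((L / L) / L) = L / L ∧
      L.map (π : A →+ B).toIntLinearMap = L₀ := by
  -- Thm. 7.3 «⇒» in `B`: `(L_0)_(p) = b_pΛ_0,(p)` with `b_p = 1` off `P_0`
  obtain ⟨b, P₀, hb, hloc⟩ := exists_forall_prime_locEq_units_smul_of_mul_div_div_eq hL₀ hinv₀
  rw [hO₀] at hloc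
  -- lift the units along `σ` and glue `L` with `L_(p) = a_pΛ_(p)` (Thm. 7.2 (c))
  obtain ⟨L, hL, hLU⟩ := exists_isFullLattice_forall_prime_locEq hΛ
    (U := fun p => Units.map (σ : B →* A) (b p) • Λ) (fun p => hΛ.units_smul _) P₀
    (fun p hp => by simp only [hb p hp, map_one, one_smul])
  have hΛO : Λ / Λ = Λ := div_self_eq_of_one_mem h1 hΛΛ
  -- `𝒪(L) = Λ` and `L` is invertible (Thm. 7.3 «⇐»)
  have hO : L / L = Λ := eq_of_forall_prime_locEq fun p hp => by
    have h := locEq_div hp (hLU p hp) (hLU p hp)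
    rwa [div_self_units_smul, hΛO] at h
  have hinv : L * ((L / L) / L) = L / L :=
    mul_div_div_eq_of_forall_prime_locEq_units_smul hL (fun p => Units.map (σ : B →* A) (b p)) P₀
      (fun p hp => by simp only [hb p hp, map_one]) fun p hp => by
      rw [hO]; exact hLU p hp
  refine ⟨L, hL, hO, hinv, eq_of_forall_prime_locEq fun p hp => ?_⟩
  -- `π(L)_(p) = π(a_pΛ)_(p) = b_pπ(Λ)_(p) = (L_0)_(p)`
  have h := locEq_map π (hLU p hp)
  have hπa : Units.map (π : A →* B) (Units.map (σ : B →* A) (b p)) = b p := Units.ext (hσ _)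
  rw [map_units_smul, hπa] at h
  exact locEq_trans hp h (locEq_symm (hloc p hp))

end Surjective

end Literature.NumberTheory.ComplexMultiplication.FiniteQAlgebraLattice
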